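import Mathlib

/-!
# `NewtonTauWeak` (stmt-ValiantsHypothesis-5904), sub-stub `fixedKCoincidence_t2_K3`: ray polynomials and the
# piece lemma (file 1 of the `FixedK3` series)

Support file for the crux `Summit.ValiantsHypothesis.ValiantsHypothesis.Theses.NewtonUnitEquations.NewtonTauWeak`
(KPTT arXiv:1308.2286, Conj. 1 in the weak form of their Thm 1), line `binomial-normal-form`, registered sub-stub
`fixedKCoincidence_t2_K3` (three products of binomials over a common exponent list without short 2-vs-1 relations
among the exponent directions).  This file is the elementary tool-box of the local (corner) analysis, everything
over `MvPolynomial (Fin 2) ℂ` with an additive integer weight `φ` that is positive on nonzero exponents: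

* parallel exponents on a common ray are componentwise comparable (`le_or_ge_of_par`), so a nonempty finite set of
  exponents on one ray has a least element for EVERY positive weight at once (`exists_least_of_par`);
* weight lower bounds and lowest coefficients of products (`le_wt_of_mem_support_mul`, `coeff_mul_at_min`,
  `prod_at_min`);
* the PIECE LEMMA `k7_strictMin_mem_of_pieces`: if `G = Σ_i P_i` where every LIVE piece has an explicit unique
  lightest exponent `c_i` with nonzero coefficient, the live `c_i` have distinct weights, and every exponent of a
  non-live piece is strictly heavier than some live `c_j`, then the unique `φ`-lightest exponent of `G` is one of
  the live `c_i`.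

No definitions; statements are inlined over Mathlib (parallelism of `x y : Fin 2 →₀ ℕ` is `x 0 * y 1 = x 1 * y 0`).
[folklore]
-/

-- the namespace mandated for this Theorems file repeats the component `ValiantsHypothesis`
set_option linter.dupNamespace false

noncomputable section

open scoped BigOperators
open MvPolynomial

namespace Summit.ValiantsHypothesis.ValiantsHypothesis.Theorems.NewtonUnitEquationsNewtonTauWeak.FixedK3

/-! ## Parallel exponents -/

/-- Parallelism to a nonzero vector is transitive. [folklore] -/
theorem par_trans {x y v : Fin 2 →₀ ℕ} (hv : v ≠ 0) (hx : x 0 * v 1 = x 1 * v 0) (hy : y 0 * v 1 = y 1 * v 0) :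
    x 0 * y 1 = x 1 * y 0 := by
  by_cases h0 : v 0 = 0
  · have h1 : v 1 ≠ 0 := by
      intro h1; apply hv; ext i; fin_cases i <;> simp [h0, h1]
    rw [h0, mul_zero] at hx hy
    have hx0 : x 0 = 0 := (mul_eq_zero.mp hx).resolve_right h1
    have hy0 : y 0 = 0 := (mul_eq_zero.mp hy).resolve_right h1
    simp [hx0, hy0]
  · have key : (x 0 * y 1) * v 0 = (x 1 * y 0) * v 0 := by
      calc (x 0 * y 1) * v 0 = x 0 * (y 1 * v 0) := by ring
        _ = x 0 * (y 0 * v 1) := by rw [hy]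
        _ = (x 0 * v 1) * y 0 := by ring
        _ = (x 1 * v 0) * y 0 := by rw [hx]
        _ = (x 1 * y 0) * v 0 := by ring
    exact Nat.eq_of_mul_eq_mul_right (Nat.pos_of_ne_zero h0) key

/-- Sums of exponents parallel to `v` are parallel to `v`. [folklore] -/
theorem par_add {x y v : Fin 2 →₀ ℕ} (hx : x 0 * v 1 = x 1 * v 0) (hy : y 0 * v 1 = y 1 * v 0) :
    (x + y) 0 * v 1 = (x + y) 1 * v 0 := by
  simp only [Finsupp.coe_add, Pi.add_apply]
  linear_combination hx + hy

/-- A finite sum of exponents parallel to `v` is parallel to `v`. [folklore] -/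
theorem par_sum {ι : Type*} (s : Finset ι) (x : ι → Fin 2 →₀ ℕ) (v : Fin 2 →₀ ℕ)
    (h : ∀ i ∈ s, x i 0 * v 1 = x i 1 * v 0) : (∑ i ∈ s, x i) 0 * v 1 = (∑ i ∈ s, x i) 1 * v 0 := by
  classical
  induction s using Finset.induction_on with
  | empty => simp
  | insert a s ha ih =>
    rw [Finset.sum_insert ha]
    exact par_add (h a (Finset.mem_insert_self a s)) (ih fun i hi => h i (Finset.mem_insert_of_mem hi))

/-- Two exponents on a common ray (parallel to a nonzero `v`) are componentwise comparable. [folklore] -/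
theorem le_or_ge_of_par {x y v : Fin 2 →₀ ℕ} (hv : v ≠ 0) (hx : x 0 * v 1 = x 1 * v 0)
    (hy : y 0 * v 1 = y 1 * v 0) : (x 0 ≤ y 0 ∧ x 1 ≤ y 1) ∨ (y 0 ≤ x 0 ∧ y 1 ≤ x 1) := by
  have hxy := par_trans hv hx hy
  rcases le_total (x 0) (y 0) with h0 | h0
  · rcases le_total (x 1) (y 1) with h1 | h1
    · exact Or.inl ⟨h0, h1⟩
    · -- x 0 ≤ y 0, y 1 ≤ x 1
      rcases h0.eq_or_lt with h0' | h0'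
      · rcases h1.eq_or_lt with h1' | h1'
        · exact Or.inl ⟨h0, h1'.symm.le⟩
        · -- x0 = y0, y1 < x1: then x0*y1 = x1*y0 = x1 * x0 forces x0 = 0 or y1 = x1
          right; refine ⟨h0'.symm.le, h1⟩
      · rcases h1.eq_or_lt with h1' | h1'
        · exact Or.inl ⟨h0, h1'.symm.le⟩
        · exfalso
          have : x 0 * y 1 < y 0 * x 1 := by
            calc x 0 * y 1 ≤ x 0 * x 1 := Nat.mul_le_mul_left _ h1
              _ < y 0 * x 1 := by
                  have hx1 : 0 < x 1 := lt_of_le_of_lt (Nat.zero_le _) h1'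
                  exact Nat.mul_lt_mul_of_pos_right h0' hx1 |>.trans_le le_rfl
          rw [hxy, mul_comm] at this
          exact lt_irrefl _ this
  · rcases le_total (x 1) (y 1) with h1 | h1
    · rcases h0.eq_or_lt with h0' | h0'
      · exact Or.inl ⟨h0'.symm.le, h1⟩
      · rcases h1.eq_or_lt with h1' | h1'
        · exact Or.inr ⟨h0, h1'.symm.le⟩
        · exfalso
          have : y 0 * x 1 < x 0 * y 1 := by
            calc y 0 * x 1 ≤ y 0 * y 1 := Nat.mul_le_mul_left _ h1'.le
              _ < x 0 * y 1 := by
                  have hy1 : 0 < y 1 := lt_of_le_of_lt (Nat.zero_le _) h1'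
                  exact Nat.mul_lt_mul_of_pos_right h0' hy1
          rw [hxy, mul_comm] at this
          exact lt_irrefl _ this
    · exact Or.inr ⟨h0, h1⟩

/-- A nonzero exponent parallel to two vectors makes them parallel. [folklore] -/
theorem par_of_par_of_par {z v v' : Fin 2 →₀ ℕ} (hz : z ≠ 0) (h : z 0 * v 1 = z 1 * v 0)
    (h' : z 0 * v' 1 = z 1 * v' 0) : v 0 * v' 1 = v 1 * v' 0 := by
  have hv : v 0 * z 1 = v 1 * z 0 := by linarith [h]
  have hv' : v' 0 * z 1 = v' 1 * z 0 := by linarith [h']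
  exact par_trans hz hv hv'

/-! ## Additive positive weights -/

/-- Componentwise `≤` and `≠` give a strictly smaller weight, for every additive weight positive on nonzero
exponents. [folklore] -/
theorem wt_lt_of_le_of_ne (φ : (Fin 2 →₀ ℕ) →+ ℤ) (hpos : ∀ p : Fin 2 →₀ ℕ, p ≠ 0 → 0 < φ p)
    {x y : Fin 2 →₀ ℕ} (h0 : x 0 ≤ y 0) (h1 : x 1 ≤ y 1) (hne : x ≠ y) : φ x < φ y := by
  have hle : x ≤ y := fun i => by fin_cases i <;> assumption
  obtain ⟨d, rfl⟩ := exists_add_of_le hle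
  have hd : d ≠ 0 := by rintro rfl; exact hne (by simp)
  rw [map_add]
  linarith [hpos d hd]

/-- Weights are nonnegative. [folklore] -/
theorem wt_nonneg (φ : (Fin 2 →₀ ℕ) →+ ℤ) (hpos : ∀ p : Fin 2 →₀ ℕ, p ≠ 0 → 0 < φ p) (p : Fin 2 →₀ ℕ) :
    0 ≤ φ p := by
  by_cases hp : p = 0
  · rw [hp, map_zero]
  · exact (hpos p hp).le

/-- LEAST ELEMENT ON A RAY: a nonempty finite set of exponents on one ray has an element that is componentwise below
all others, hence strictly lighter than every other element for every positive additive weight. [folklore] -/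
theorem exists_least_of_par {v : Fin 2 →₀ ℕ} (hv : v ≠ 0) (T : Finset (Fin 2 →₀ ℕ)) (hT : T.Nonempty)
    (hray : ∀ z ∈ T, z 0 * v 1 = z 1 * v 0) :
    ∃ m ∈ T, ∀ z ∈ T, m 0 ≤ z 0 ∧ m 1 ≤ z 1 := by
  obtain ⟨m, hm, hmin⟩ := T.exists_min_image (fun z : Fin 2 →₀ ℕ => z 0 + z 1) hT
  refine ⟨m, hm, fun z hz => ?_⟩
  rcases le_or_ge_of_par hv (hray m hm) (hray z hz) with h | h
  · exact h
  · have hle := hmin z hz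
    have : z 0 + z 1 ≤ m 0 + m 1 := Nat.add_le_add h.1 h.2
    have heq0 : z 0 = m 0 := by omega
    have heq1 : z 1 = m 1 := by omega
    exact ⟨heq0.symm.le, heq1.symm.le⟩

/-- The least element on a ray is strictly lighter than the other elements. [folklore] -/
theorem wt_lt_of_least (φ : (Fin 2 →₀ ℕ) →+ ℤ) (hpos : ∀ p : Fin 2 →₀ ℕ, p ≠ 0 → 0 < φ p)
    {T : Finset (Fin 2 →₀ ℕ)} {m : Fin 2 →₀ ℕ} (hle : ∀ z ∈ T, m 0 ≤ z 0 ∧ m 1 ≤ z 1)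
    {z : Fin 2 →₀ ℕ} (hz : z ∈ T) (hne : z ≠ m) : φ m < φ z :=
  wt_lt_of_le_of_ne φ hpos (hle z hz).1 (hle z hz).2 (Ne.symm hne)

/-! ## Weights of supports of products -/

/-- Lower weight bounds add under multiplication. [folklore] -/
theorem le_wt_of_mem_support_mul (φ : (Fin 2 →₀ ℕ) →+ ℤ) (A B : MvPolynomial (Fin 2) ℂ) (a b : ℤ)
    (hA : ∀ z ∈ A.support, a ≤ φ z) (hB : ∀ z ∈ B.support, b ≤ φ z) :
    ∀ z ∈ (A * B).support, a + b ≤ φ z := by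
  classical
  intro z hz
  obtain ⟨x, hx, y, hy, rfl⟩ := Finset.mem_add.mp (support_mul A B hz)
  rw [map_add]
  exact add_le_add (hA x hx) (hB y hy)

/-- Lower weight bounds add over finite products. [folklore] -/
theorem le_wt_of_mem_support_prod {ι : Type*} (φ : (Fin 2 →₀ ℕ) →+ ℤ) (s : Finset ι)
    (Q : ι → MvPolynomial (Fin 2) ℂ) (b : ι → ℤ) (hb : ∀ i ∈ s, ∀ z ∈ (Q i).support, b i ≤ φ z) :
    ∀ z ∈ (∏ i ∈ s, Q i).support, ∑ i ∈ s, b i ≤ φ z := by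
  classical
  induction s using Finset.induction_on with
  | empty =>
    intro z hz
    rw [Finset.prod_empty] at hz
    have : z = 0 := by
      have h := support_one (R := ℂ) (σ := Fin 2) ▸ hz
      simpa using h
    simp [this]
  | insert a s ha ih =>
    intro z hz
    rw [Finset.prod_insert ha] at hz
    rw [Finset.sum_insert ha]
    exact le_wt_of_mem_support_mul φ _ _ _ _ (hb a (Finset.mem_insert_self a s))
      (ih fun i hi => hb i (Finset.mem_insert_of_mem hi)) z hz

/-- LOWEST COEFFICIENT OF A PRODUCT: if `p` is strictly lighter than every other exponent of `A` and `q` than every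
other exponent of `B` (neither needs to lie in the support), then `coeff (p + q) (A * B) = coeff p A * coeff q B` and
`p + q` is strictly lighter than every other exponent of `A * B`. [folklore] -/
theorem coeff_mul_at_min (φ : (Fin 2 →₀ ℕ) →+ ℤ) (A B : MvPolynomial (Fin 2) ℂ) (p q : Fin 2 →₀ ℕ)
    (hA : ∀ z ∈ A.support, z ≠ p → φ p < φ z) (hB : ∀ z ∈ B.support, z ≠ q → φ q < φ z) :
    coeff (p + q) (A * B) = coeff p A * coeff q B ∧
      ∀ z ∈ (A * B).support, z ≠ p + q → φ (p + q) < φ z := by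
  classical
  have hA' : ∀ z ∈ A.support, φ p ≤ φ z := fun z hz => by
    rcases eq_or_ne z p with rfl | hne
    · exact le_rfl
    · exact (hA z hz hne).le
  have hB' : ∀ z ∈ B.support, φ q ≤ φ z := fun z hz => by
    rcases eq_or_ne z q with rfl | hne
    · exact le_rfl
    · exact (hB z hz hne).le
  constructor
  · rw [coeff_mul, Finset.sum_eq_single_of_mem (p, q) (by simp)]
    rintro ⟨x, y⟩ hxy hne
    have hxy' : x + y = p + q := Finset.HasAntidiagonal.mem_antidiagonal.mp hxy
    by_contra h
    have hx : x ∈ A.support := mem_support_iff.mpr (left_ne_zero_of_mul h)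
    have hy : y ∈ B.support := mem_support_iff.mpr (right_ne_zero_of_mul h)
    have hw : φ x + φ y = φ p + φ q := by rw [← map_add, ← map_add, hxy']
    have hxp : x = p := by
      by_contra hxp
      have := hA x hx hxp
      linarith [hB' y hy]
    have hyq : y = q := by
      subst hxp
      exact add_left_cancel hxy'
    exact hne (Prod.ext hxp hyq)
  · intro z hz hne
    obtain ⟨x, hx, y, hy, rfl⟩ := Finset.mem_add.mp (support_mul A B hz)
    rw [map_add, map_add]
    rcases eq_or_ne x p with rfl | hxp
    · have hyq : y ≠ q := fun h => hne (by rw [h])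
      linarith [hB y hy hyq]
    · linarith [hA x hx hxp, hB' y hy]

/-- LOWEST COEFFICIENT OF A FINITE PRODUCT (same hypotheses factorwise). [folklore] -/
theorem prod_at_min {ι : Type*} (φ : (Fin 2 →₀ ℕ) →+ ℤ) (s : Finset ι) (Q : ι → MvPolynomial (Fin 2) ℂ)
    (c : ι → Fin 2 →₀ ℕ) (hQ : ∀ i ∈ s, ∀ z ∈ (Q i).support, z ≠ c i → φ (c i) < φ z) :
    coeff (∑ i ∈ s, c i) (∏ i ∈ s, Q i) = ∏ i ∈ s, coeff (c i) (Q i) ∧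
      ∀ z ∈ (∏ i ∈ s, Q i).support, z ≠ ∑ i ∈ s, c i → φ (∑ i ∈ s, c i) < φ z := by
  classical
  induction s using Finset.induction_on with
  | empty =>
    refine ⟨by simp, fun z hz hne => ?_⟩
    rw [Finset.prod_empty] at hz
    have h := support_one (R := ℂ) (σ := Fin 2) ▸ hz
    simp only [Finset.mem_singleton] at h
    exact absurd h (by simpa using hne)
  | insert a s ha ih =>
    have ih' := ih fun i hi => hQ i (Finset.mem_insert_of_mem hi)
    rw [Finset.prod_insert ha, Finset.sum_insert ha, Finset.prod_insert ha]
    have h := coeff_mul_at_min φ (Q a) (∏ i ∈ s, Q i) (c a) (∑ i ∈ s, c i)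
      (hQ a (Finset.mem_insert_self a s)) ih'.2
    exact ⟨h.1.trans (by rw [ih'.1]), h.2⟩

/-- A polynomial with constant term `1`: `0` is strictly lighter than every other exponent. [folklore] -/
theorem zero_min_of_coeff_zero (φ : (Fin 2 →₀ ℕ) →+ ℤ) (hpos : ∀ p : Fin 2 →₀ ℕ, p ≠ 0 → 0 < φ p)
    (A : MvPolynomial (Fin 2) ℂ) : ∀ z ∈ A.support, z ≠ 0 → φ 0 < φ z := fun z _ hz => by
  rw [map_zero]; exact hpos z hz

/-! ## The piece lemma -/

/-- **Piece lemma.**  Let `G = Σ_{i ∈ I} P_i`.  Suppose every live piece `i ∈ L ⊆ I` has an exponent `c_i` with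
nonzero coefficient that is strictly lighter than its other exponents, the live `c_i` have pairwise distinct weights,
and every exponent of a non-live piece is strictly heavier than some live `c_j`.  Then an exponent of `G` that is
strictly lighter than all other exponents of `G` is one of the live `c_i`. [folklore] -/
theorem k7_strictMin_mem_of_pieces {ι : Type*} (φ : (Fin 2 →₀ ℕ) →+ ℤ) (I L : Finset ι) (hLI : L ⊆ I)
    (P : ι → MvPolynomial (Fin 2) ℂ) (c : ι → Fin 2 →₀ ℕ)
    (hlive : ∀ i ∈ L, coeff (c i) (P i) ≠ 0 ∧ ∀ z ∈ (P i).support, z ≠ c i → φ (c i) < φ z)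
    (hdist : ∀ i ∈ L, ∀ j ∈ L, i ≠ j → φ (c i) ≠ φ (c j))
    (hdom : ∀ i ∈ I, i ∉ L → ∀ z ∈ (P i).support, ∃ j ∈ L, φ (c j) < φ z)
    (e : Fin 2 →₀ ℕ) (he : e ∈ (∑ i ∈ I, P i).support)
    (hmin : ∀ z ∈ (∑ i ∈ I, P i).support, z ≠ e → φ e < φ z) : ∃ i ∈ L, e = c i := by
  classical
  -- `e` lies in the support of some piece
  obtain ⟨i₀, hi₀, he₀⟩ : ∃ i ∈ I, e ∈ (P i).support := by
    have h := support_sum (s := I) (f := P) he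
    simpa only [Finset.mem_biUnion] using h
  -- there is a live piece, hence a lightest live point
  have hLne : L.Nonempty := by
    by_cases hi₀L : i₀ ∈ L
    · exact ⟨i₀, hi₀L⟩
    · obtain ⟨j, hj, -⟩ := hdom i₀ hi₀ hi₀L e he₀
      exact ⟨j, hj⟩
  obtain ⟨j, hj, hjmin⟩ := L.exists_min_image (fun i => φ (c i)) hLne
  -- the lightest live point is an exponent of `G`
  have hcj : c j ∈ (∑ i ∈ I, P i).support := by
    rw [mem_support_iff, coeff_sum, Finset.sum_eq_single_of_mem j (hLI hj)]
    · exact (hlive j hj).1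
    · intro i hi hij
      by_contra hne
      have hmem : c j ∈ (P i).support := mem_support_iff.mpr hne
      by_cases hiL : i ∈ L
      · rcases eq_or_ne (c j) (c i) with h | h
        · exact hdist i hiL j hj hij (by rw [h])
        · have h1 := (hlive i hiL).2 (c j) hmem h
          have h2 := hjmin i hiL
          exact absurd h1 (not_lt.mpr h2)
      · obtain ⟨k, hk, hlt⟩ := hdom i hi hiL (c j) hmem
        exact absurd hlt (not_lt.mpr (hjmin k hk))
  -- compare `e` with `c j`
  have hej : φ e ≤ φ (c j) := by
    rcases eq_or_ne (c j) e with h | h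
    · rw [h]
    · exact (hmin (c j) hcj h).le
  by_cases hi₀L : i₀ ∈ L
  · rcases eq_or_ne e (c i₀) with h | h
    · exact ⟨i₀, hi₀L, h⟩
    · have h1 := (hlive i₀ hi₀L).2 e he₀ h
      have h2 := hjmin i₀ hi₀L
      exact absurd (h1.trans_le (hej.trans h2)) (lt_irrefl _)
  · obtain ⟨k, hk, hlt⟩ := hdom i₀ hi₀ hi₀L e he₀
    exact absurd (hlt.trans_le (hej.trans (hjmin k hk))) (lt_irrefl _)

end Summit.ValiantsHypothesis.ValiantsHypothesis.Theorems.NewtonUnitEquationsNewtonTauWeak.FixedK3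

end
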